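import Literature.NumberTheory.Automorphic.AutomorphicTwist
import Literature.NumberTheory.Automorphic.UnitaryGroupAdelicOneTorusDictionary
import Literature.NumberTheory.Automorphic.UnitaryGroupAdelicDet
import Literature.NumberTheory.Automorphic.UnitaryGroupAdelicCenterRational
import Literature.NumberTheory.Automorphic.UnitaryGroupPlaceInclusion
import Literature.NumberTheory.Automorphic.UnitaryGroupLocalCenterScalar
import Literature.NumberTheory.Automorphic.TorusCharacterRigidityCofinite
import Literature.NumberTheory.Rogawski1990.XiLocalCharacter
import HarnessLib

/-!
# The automorphic character `ψ ∘ det` of `U(J)(𝔸_F)` of an automorphic character `ψ` of the norm-one torus, and its local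
# components `(ψ ∘ det)|_{U(J)(F_v)} = ψ_v ∘ det`

Topic `NumberTheory/Automorphic`; namespace `Literature.NumberTheory.Automorphic.UnitaryGroup`.  One definition WITH BODY (`detChar`) and
proved theorems; no named fact, no instance, no notation, no `sorry`.

Setting: `E/F` quadratic with non-trivial automorphism `c` (`h2 : [E : F] = 2`, `hc : c ≠ 1`), a matrix `J ∈ M_N(E)` with `det J ≠ 0`, the unitary
group datum `UnitaryGroup.adelicGroupData F E c N J` (★), the norm-one torus `T(𝔸_F) = TorusDict.torus c ≤ 𝕀_E` (★) `= UnitaryGroup.adelicOne F E c`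
(★ `adelicOne_eq_torus`), its continuous characters `ψ : T(𝔸_F) →ₜ* ℂˣ`, the determinant `det : U(J)(𝔸_F) →* U(1)(𝔸_F)` (★ `adelicDet`), and
the local currencies ★ `torusLocalComponent E c v ψ = ψ ∘ locTorusIncl v : T(F_v) →* ℂˣ`, ★ `localDet c v : U(J)(F_v) →* T(F_v)`,
★ `inclPlaceAdelic v = finAdelicToAdelic ∘ inclPlace v : U(J)(F_v) (Π-model) →* U(J)(𝔸_F)`, ★ `localPiEquiv v` (Π-model ≃ matrix model).

* §1 **`detChar ψ hψ hJ : (adelicGroupData F E c N J).AutomorphicCharacter`** — `g ↦ ψ(det g)` (★ `adelicOneChar ψ ∘ adelicDet`): continuous,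
  unitary (★ `norm_torusHom_apply_eq_one_of_isAutomorphic`), trivial on `U(J)(F)` (★ `coe_adelicDet_toAdelic`: `det` of a rational point is a
  principal idele; ★ `forall_adelicOneChar_eq_one_iff`).  «`ξ(h) = η(det₀ h) ψ(det h)`» is `detChar η · detChar ψ ∘ ι` [Rogawski1990, §13.3 p. 202].
* §2 **LOCAL COMPONENTS**: `detChar ψ (inclPlaceAdelic v k) = torusLocalComponent v ψ (localDet v (localPiEquiv v k))`
  (`detChar_inclPlaceAdelic`) — the idele `det (1, …, k, …, 1)` IS the block idele of `det k ∈ T(F_v)` (★ `semilocalUnits`): archimedean part `1`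
  (★ `map_fst_ofFinite`), component `det k_w` at `w ∣ v` (★ `evalAt_inclPlace_of_over`) and `1` at `w ∤ v` (★ `evalAt_inclPlace_of_not_over`);
  as homomorphisms `U(J)(F_v) →* ℂˣ` in both models (`detChar_comp_inclPlaceAdelic`, `…_comp_localPiEquiv_symm`).
* §3 **`N = 1`**: `U(J₁)(𝔸_F) = det⁻¹(U(1)(𝔸_F))` — `g = (det g) · 1₁` (`adelicCenter_adelicDet_of_one`), so EVERY unitary automorphic character of
  `U(J₁)(𝔸_F)` is `detChar` of an automorphic torus character (`exists_eq_detChar_of_one`); the local determinant `U(J₁)(F_v) → T(F_v)` is onto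
  (`exists_localDet_localPiEquiv_eq_of_one`, via ★ `localUnitScalar`); hence **two unitary automorphic characters of `U(J₁)(𝔸_F)` which agree on
  `U(J₁)(F_v)` for all finite `v` outside a finite set are EQUAL** (`AutomorphicCharacter.eq_of_forall_comp_inclPlaceAdelic_eq_of_one`) — ★
  `torusCharacter_eq_of_torusLocalComponent_eq_of_not_mem` (Tate density, incl. the archimedean places) read on `U(J₁)`.
* §4 the CM specialisations (`L`, `L⁺`, complex conjugation; `h2`, `hc` discharged).

Consumers: the `U(1)` line of LH7 (crux H413, ★ `Realises₁` of `Theorems/F0P3cPKtupleHSideLetters`) over ★ `AutomorphicCharacterLine` ∕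
★ `CharacterLineFinConstituents`.  HC_CM is proved only modulo the printed citations until rung 0 closes; this file moves no count.

## References
* [Rogawski1990] J. Rogawski, *Automorphic representations of unitary groups in three variables* (1990), §12.2 pp. 173–174 (`ξ_v`), §13.3 p. 202
  («`ξ(h) = η(det₀ h) ψ(det h)`»).
* [Mok2014] C. P. Mok, Mem. AMS 235 (2015), §1 Notation p. 5 (`det : U(N) → U(1)`).
* [TateThesis1967] J. Tate, in Cassels–Fröhlich (1967), §3.2 (local components of idele characters); Ch. VII §4 Prop. 4.1.
* [PlatonovRapinchuk1994] V. Platonov, A. Rapinchuk, *Algebraic Groups and Number Theory* (1994), §6.2 (the norm-one torus), §7.3 Prop. 7.8.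
-/

set_option autoImplicit false

noncomputable section

open NumberField IsDedekindDomain Topology
open Literature.NumberTheory.GaloisRepresentations
open Literature.NumberTheory.Automorphic.Arthur2013.Leaves.TECR

namespace Literature.NumberTheory.Automorphic

namespace UnitaryGroup

section Quadratic

variable (F E : Type) [Field F] [NumberField F] [Field E] [NumberField E] [Algebra F E] (c : E ≃ₐ[F] E)
  (h2 : Module.finrank F E = 2) (hc : c ≠ 1) (N : ℕ) (J : Matrix (Fin N) (Fin N) E)

/-! ## §1 The automorphic character `ψ ∘ det` of `U(J)(𝔸_F)` -/

omit [NumberField F] in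
/-- `det (γ ⊗ 1)` is a principal idele for `γ ∈ U(J)(F)` (★ `coe_adelicDet_toAdelic`). [cite: Mok2014, §1 Notation p. 5] -/
theorem coe_adelicDet_toAdelic_mem_principalIdeles (hJ : J.det ≠ 0) (γ : rational F E c N J) :
    ((adelicDet F E c N J hJ (toAdelic F E c N J γ) : adelicOne F E c) : ideleGroup E) ∈ principalIdeles E :=
  ⟨Matrix.GeneralLinearGroup.det (γ : GL (Fin N) E), (coe_adelicDet_toAdelic F E c N J hJ γ).symm⟩

/-- The quotient subgroup of the unitary datum is `U(J)(F)` (its split centre `A_G` is trivial). [cite: Mok2014, §1 Notation p. 5] -/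
theorem mem_quotientSubgroup_adelicGroupData_iff (g : (adelicGroupData F E c N J).Adelic) :
    g ∈ (adelicGroupData F E c N J).quotientSubgroup ↔ ∃ γ : rational F E c N J, toAdelic F E c N J γ = g := by
  change g ∈ (⊥ : Subgroup (adelic F E c N J)) ⊔ (toAdelic F E c N J).range ↔ _
  rw [bot_sup_eq]
  exact Iff.rfl

include h2 hc in
/-- **`detChar ψ = ψ ∘ det`, the unitary automorphic character of `U(J)(𝔸_F)` attached to an automorphic character `ψ` of the norm-one torus
`T(𝔸_F)`** (★ `AutomorphicCharacter`: continuous, `|·| = 1`, trivial on `U(J)(F)`).  «`ψ(det h)`». [cite: Rogawski1990, §13.3 p. 202] [cite: Mok2014, §1 Notation p. 5] -/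
def detChar (ψ : ↥(TorusDict.torus c) →ₜ* ℂˣ) (hψ : TorusDict.IsAutomorphic c ψ) (hJ : J.det ≠ 0) :
    (adelicGroupData F E c N J).AutomorphicCharacter where
  toMonoidHom := (adelicOneChar F E c ψ).comp (adelicDet F E c N J hJ)
  continuous_coe := Units.continuous_val.comp ((continuous_adelicOneChar F E c ψ).comp (continuous_adelicDet F E c N J hJ))
  norm_apply g := norm_torusHom_apply_eq_one_of_isAutomorphic F E c h2 hc ψ hψ _
  map_eq_one_of_mem g hg := by
    obtain ⟨γ, rfl⟩ := (mem_quotientSubgroup_adelicGroupData_iff F E c N J g).1 hg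
    exact (forall_adelicOneChar_eq_one_iff F E c ψ).2 hψ _ (coe_adelicDet_toAdelic_mem_principalIdeles F E c N J hJ γ)

/-- Unfolding: `detChar ψ g = ψ (det g)` (the idele `det g` read in `T(𝔸_F)`). [cite: Rogawski1990, §13.3 p. 202] -/
theorem detChar_apply (ψ : ↥(TorusDict.torus c) →ₜ* ℂˣ) (hψ : TorusDict.IsAutomorphic c ψ) (hJ : J.det ≠ 0) (g : (adelicGroupData F E c N J).Adelic) :
    detChar F E c h2 hc N J ψ hψ hJ g = ψ (adelicOneEquivTorus F E c (adelicDet F E c N J hJ g)) :=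
  rfl

/-- `detChar` is multiplicative in `ψ`: `(ψψ′) ∘ det = (ψ ∘ det)(ψ′ ∘ det)`. [cite: Rogawski1990, §13.3 p. 202] -/
theorem detChar_mul_apply (ψ ψ' : ↥(TorusDict.torus c) →ₜ* ℂˣ) (hψ : TorusDict.IsAutomorphic c ψ) (hψ' : TorusDict.IsAutomorphic c ψ')
    (hψψ' : TorusDict.IsAutomorphic c (ψ * ψ')) (hJ : J.det ≠ 0) (g : (adelicGroupData F E c N J).Adelic) :
    detChar F E c h2 hc N J (ψ * ψ') hψψ' hJ g = detChar F E c h2 hc N J ψ hψ hJ g * detChar F E c h2 hc N J ψ' hψ' hJ g :=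
  rfl

/-! ## §2 Local components: `(ψ ∘ det)(1, …, k, …, 1) = ψ_v (det k)` -/

/-- The `w`-component (`w ∣ v`) of the finite idele `det (inclPlace v k)` is `det k_w` (private twin of the crux-side ★
`F0P5CurveThetaCompanionDetTwist.det_inclPlace_apply_of_over`). [cite: PlatonovRapinchuk1994, §6.2] -/
private theorem det_inclPlace_apply_of_over (v : HeightOneSpectrum (𝓞 F)) (k : localPi E c N J v) (w : PlacesOver E v) :
    ((Matrix.GeneralLinearGroup.det (inclPlace F E c N J v k).1 : (FiniteAdeleRing (𝓞 E) E)ˣ) : FiniteAdeleRing (𝓞 E) E) w.1 =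
      (((k : LocalGLPi E N v) w : GL (Fin N) (w.1.adicCompletion E)) : Matrix (Fin N) (Fin N) (w.1.adicCompletion E)).det := by
  rw [Matrix.GeneralLinearGroup.val_det_apply, ← AdelicGroupData.finiteAdeleEval_apply E w.1, RingHom.map_det, RingHom.mapMatrix_apply,
    map_eval_eq_evalAt, evalAt_inclPlace_of_over]

/-- The `w`-component (`w ∤ v`) of the finite idele `det (inclPlace v k)` is `1` (private twin of the crux-side ★ `…det_inclPlace_apply_of_not_over`).
[cite: PlatonovRapinchuk1994, §6.2] -/
private theorem det_inclPlace_apply_of_not_over (v : HeightOneSpectrum (𝓞 F)) (k : localPi E c N J v) (w : HeightOneSpectrum (𝓞 E))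
    (hw : w.under (𝓞 F) ≠ v) :
    ((Matrix.GeneralLinearGroup.det (inclPlace F E c N J v k).1 : (FiniteAdeleRing (𝓞 E) E)ˣ) : FiniteAdeleRing (𝓞 E) E) w = 1 := by
  rw [Matrix.GeneralLinearGroup.val_det_apply, ← AdelicGroupData.finiteAdeleEval_apply E w, RingHom.map_det, RingHom.mapMatrix_apply,
    map_eval_eq_evalAt, evalAt_inclPlace_of_not_over F E c N J hw k ⟨w, rfl⟩, Units.val_one, Matrix.det_one]

/-- The `w`-component (`w ∣ v`) of `det (localPiEquiv v k) ∈ (∏_{w ∣ v} E_w)ˣ` is `det k_w` (private twin of the crux-side ★ `…det_localPiEquiv_apply`).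
[cite: PlatonovRapinchuk1994, §6.2] -/
private theorem det_localPiEquiv_apply (v : HeightOneSpectrum (𝓞 F)) (k : localPi E c N J v) (w : PlacesOver E v) :
    ((Matrix.GeneralLinearGroup.det ((localPiEquiv E c N J v k : «local» E c N J v) : GL (Fin N) (LocalRing E v)) : (LocalRing E v)ˣ) :
        LocalRing E v) w =
      (((k : LocalGLPi E N v) w : GL (Fin N) (w.1.adicCompletion E)) : Matrix (Fin N) (Fin N) (w.1.adicCompletion E)).det := by
  rw [Matrix.GeneralLinearGroup.val_det_apply,
    ← Pi.evalRingHom_apply (fun w : PlacesOver E v => w.1.adicCompletion E) w (Matrix.det _), RingHom.map_det, RingHom.mapMatrix_apply,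
    coe_localPiEquiv_apply, GLn.map_piEquiv_symm]

/-- **THE IDELE `det (1, …, k, …, 1)` IS THE BLOCK IDELE OF `det k ∈ T(F_v)`**: in `T(𝔸_F) ≤ 𝕀_E`,
`det (inclPlaceAdelic v k) = locTorusIncl v (localDet v (localPiEquiv v k))`. [cite: TateThesis1967, §3.2] [cite: PlatonovRapinchuk1994, §6.2] -/
theorem adelicOneEquivTorus_adelicDet_inclPlaceAdelic (hJ : J.det ≠ 0) (v : HeightOneSpectrum (𝓞 F)) (k : localPi E c N J v) :
    adelicOneEquivTorus F E c (adelicDet F E c N J hJ (inclPlaceAdelic F E c N J v k)) =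
      locTorusIncl E c v (localDet c v (isUnit_iff_ne_zero.2 hJ) (localPiEquiv E c N J v k)) := by
  set g : adelic F E c N J := inclPlaceAdelic F E c N J v k with hg_def
  -- the underlying adelic matrix of `g` is `(1, inclPlace v k)`
  have hg : (g : GL (Fin N) (AdeleRing (𝓞 E) E)) = GLn.ofFinite N E (inclPlace F E c N J v k).1 := rfl
  refine Subtype.ext (Units.ext (Prod.ext ?_ (FiniteAdeleRing.ext E fun w => ?_)))
  · -- archimedean part: `det 1 = 1`
    rw [coe_locTorusIncl, semilocalUnits_fst, coe_adelicOneEquivTorus, coe_adelicDet]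
    change adeleFst E ((g : GL (Fin N) (AdeleRing (𝓞 E) E)) : Matrix (Fin N) (Fin N) (AdeleRing (𝓞 E) E)).det = 1
    rw [RingHom.map_det, RingHom.mapMatrix_apply, hg]
    rw [map_fst_ofFinite, Matrix.det_one]
  · -- finite part, place by place
    rw [coe_locTorusIncl, coe_adelicOneEquivTorus, coe_adelicDet]
    have hfin : ∀ w' : HeightOneSpectrum (𝓞 E),
        (Matrix.GeneralLinearGroup.det (g : GL (Fin N) (AdeleRing (𝓞 E) E)) : AdeleRing (𝓞 E) E).2 w' =
          (Matrix.GeneralLinearGroup.det (inclPlace F E c N J v k).1 : FiniteAdeleRing (𝓞 E) E) w' := by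
      intro w'
      have h2' : (Matrix.GeneralLinearGroup.det (g : GL (Fin N) (AdeleRing (𝓞 E) E)) : AdeleRing (𝓞 E) E).2 =
          (Matrix.GeneralLinearGroup.det (inclPlace F E c N J v k).1 : FiniteAdeleRing (𝓞 E) E) := by
        change adeleSnd E (Matrix.GeneralLinearGroup.det (g : GL (Fin N) (AdeleRing (𝓞 E) E)) : AdeleRing (𝓞 E) E) = _
        rw [Matrix.GeneralLinearGroup.val_det_apply, RingHom.map_det, RingHom.mapMatrix_apply, hg, Matrix.GeneralLinearGroup.val_det_apply]
        rw [map_snd_ofFinite]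
      rw [h2']
    rw [hfin w]
    by_cases hw : w.under (𝓞 F) = v
    · rw [det_inclPlace_apply_of_over F E c N J v k ⟨w, hw⟩, semilocalUnits_snd_apply_of_over E _ ⟨w, hw⟩, coe_coe_localDet]
      have hdet := det_localPiEquiv_apply F E c N J v k ⟨w, hw⟩
      rw [Matrix.GeneralLinearGroup.val_det_apply] at hdet
      exact hdet.symm
    · rw [det_inclPlace_apply_of_not_over F E c N J v k w hw, semilocalUnits_snd_apply_of_not_over E _ hw]

include h2 hc in
/-- **LOCAL COMPONENTS OF `ψ ∘ det`**: `detChar ψ (inclPlaceAdelic v k) = ψ_v (det (localPiEquiv v k))` with `ψ_v = torusLocalComponent v ψ`.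
[cite: Rogawski1990, §12.2 pp. 173–174] [cite: TateThesis1967, §3.2] -/
theorem detChar_inclPlaceAdelic (ψ : ↥(TorusDict.torus c) →ₜ* ℂˣ) (hψ : TorusDict.IsAutomorphic c ψ) (hJ : J.det ≠ 0)
    (v : HeightOneSpectrum (𝓞 F)) (k : localPi E c N J v) :
    detChar F E c h2 hc N J ψ hψ hJ (inclPlaceAdelic F E c N J v k) =
      torusLocalComponent E c v ψ (localDet c v (isUnit_iff_ne_zero.2 hJ) (localPiEquiv E c N J v k)) := by
  rw [detChar_apply, adelicOneEquivTorus_adelicDet_inclPlaceAdelic, torusLocalComponent_apply]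

include h2 hc in
/-- The same as homomorphisms `U(J)(F_v) →* ℂˣ` on the Π-model: `detChar ψ ∘ inclPlaceAdelic v = ψ_v ∘ localDet v ∘ localPiEquiv v`.
[cite: Rogawski1990, §12.2 pp. 173–174] -/
theorem detChar_comp_inclPlaceAdelic (ψ : ↥(TorusDict.torus c) →ₜ* ℂˣ) (hψ : TorusDict.IsAutomorphic c ψ) (hJ : J.det ≠ 0)
    (v : HeightOneSpectrum (𝓞 F)) :
    (detChar F E c h2 hc N J ψ hψ hJ).toMonoidHom.comp (inclPlaceAdelic F E c N J v) =
      ((torusLocalComponent E c v ψ).comp (localDet c v (isUnit_iff_ne_zero.2 hJ))).comp (localPiEquiv E c N J v).toMonoidHom :=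
  MonoidHom.ext fun k => detChar_inclPlaceAdelic F E c h2 hc N J ψ hψ hJ v k

include h2 hc in
/-- The same on the matrix model `U(J)(F_v) = «local» v`: `detChar ψ ∘ inclPlaceAdelic v ∘ (localPiEquiv v)⁻¹ = ψ_v ∘ localDet v`.
[cite: Rogawski1990, §12.2 pp. 173–174] -/
theorem detChar_comp_inclPlaceAdelic_comp_localPiEquiv_symm (ψ : ↥(TorusDict.torus c) →ₜ* ℂˣ) (hψ : TorusDict.IsAutomorphic c ψ) (hJ : J.det ≠ 0)
    (v : HeightOneSpectrum (𝓞 F)) :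
    ((detChar F E c h2 hc N J ψ hψ hJ).toMonoidHom.comp (inclPlaceAdelic F E c N J v)).comp (localPiEquiv E c N J v).symm.toMonoidHom =
      (torusLocalComponent E c v ψ).comp (localDet c v (isUnit_iff_ne_zero.2 hJ)) := by
  refine MonoidHom.ext fun u => ?_
  change detChar F E c h2 hc N J ψ hψ hJ (inclPlaceAdelic F E c N J v ((localPiEquiv E c N J v).symm u)) = _
  rw [detChar_inclPlaceAdelic, ContinuousMulEquiv.apply_symm_apply]
  rfl

/-! ## §3 `N = 1`: every automorphic character of `U(J₁)(𝔸_F)` is `ψ ∘ det`, and rigidity from the finite places -/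

omit [NumberField F] in
/-- A homomorphism `φ : G →* Mˣ` is continuous as soon as `g ↦ (φ g : M)` is; private copy of the root-level lemma of ★ `GLOneStandardLTate`.
[cite: PlatonovRapinchuk1994, §6.2] -/
private theorem continuous_units_of_continuous_val' {G M : Type*} [Group G] [TopologicalSpace G] [ContinuousInv G] [Monoid M]
    [TopologicalSpace M] (φ : G →* Mˣ) (h : Continuous fun g => (φ g : M)) : Continuous φ := by
  refine Units.continuous_iff.mpr ⟨h, (h.comp continuous_inv).congr fun g => ?_⟩
  simp only [Function.comp_apply, map_inv]

omit [NumberField F] in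
/-- `u ↦ u · 1_N : U(1)(𝔸_F) → U(J)(𝔸_F)` is continuous (private copy of ★ `UnitaryDualPair.continuous_adelicCenter`). [cite: Mok2014, §1 Notation p. 5] -/
private theorem continuous_adelicCenter' : Continuous (adelicCenter F E c N J) := by
  have h : Continuous fun u : ↥(adelicOne F E c) =>
      Units.map ((Matrix.scalar (Fin N) : AdeleRing (𝓞 E) E →+* Matrix (Fin N) (Fin N) (AdeleRing (𝓞 E) E)) :
          AdeleRing (𝓞 E) E →* Matrix (Fin N) (Fin N) (AdeleRing (𝓞 E) E)) (u : (AdeleRing (𝓞 E) E)ˣ) :=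
    (Continuous.units_map _ ((continuous_pi fun _ => continuous_id).matrix_diagonal)).comp continuous_subtype_val
  exact continuous_induced_rng.2 h


variable (J₁ : Matrix (Fin 1) (Fin 1) E)

omit [NumberField F] in
/-- **`g = (det g) · 1₁` for `g ∈ U(J₁)(𝔸_F)`** (`1 × 1` matrices): the centre map `U(1)(𝔸_F) → U(J₁)(𝔸_F)` inverts `det`.
[cite: Mok2014, §1 Notation p. 5] -/
theorem adelicCenter_adelicDet_of_one (hJ₁ : J₁.det ≠ 0) (g : adelic F E c 1 J₁) :
    adelicCenter F E c 1 J₁ (adelicDet F E c 1 J₁ hJ₁ g) = g := by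
  refine Subtype.ext (Units.ext (Matrix.ext fun i j => ?_))
  rw [coe_adelicCenter, coe_adelicDet, Matrix.smul_apply, Matrix.GeneralLinearGroup.val_det_apply, Matrix.det_fin_one]
  fin_cases i; fin_cases j
  simp

include h2 hc in
/-- **Every unitary automorphic character of `U(J₁)(𝔸_F)` is `ψ ∘ det` for an automorphic character `ψ` of the norm-one torus** (`N = 1`):
`ψ(u) := Θ(u · 1₁)` read on `T(𝔸_F)` (★ `torusChar`); automorphy of `ψ` = triviality of `Θ` on the rational scalars `x · 1₁`, `x ∈ E¹`.
[cite: Rogawski1990, §13.3 p. 202] [cite: PlatonovRapinchuk1994, §6.2] -/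
theorem exists_eq_detChar_of_one (hJ₁ : J₁.det ≠ 0) (Θ : (adelicGroupData F E c 1 J₁).AutomorphicCharacter) :
    ∃ (ψ : ↥(TorusDict.torus c) →ₜ* ℂˣ) (hψ : TorusDict.IsAutomorphic c ψ), detChar F E c h2 hc 1 J₁ ψ hψ hJ₁ = Θ := by
  -- `α := Θ ∘ (centre) : U(1)(𝔸_F) →* ℂˣ`, continuous
  set α : adelicOne F E c →* ℂˣ := Θ.toMonoidHom.comp (adelicCenter F E c 1 J₁) with hα_def
  have hαc : Continuous α :=
    continuous_units_of_continuous_val' α (Θ.continuous.comp (continuous_adelicCenter' F E c 1 J₁))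
  -- automorphy: a principal norm-one idele `x` gives the RATIONAL point `x · 1₁` (★ `adelicCenter_mem_range_toAdelic`)
  have hαaut : ∀ u : adelicOne F E c, (u : ideleGroup E) ∈ principalIdeles E → α u = 1 := by
    intro u hu
    obtain ⟨γ, hγ⟩ := adelicCenter_mem_range_toAdelic F E c 1 J₁ u hu
    change Θ (adelicCenter F E c 1 J₁ u) = 1
    rw [← hγ]
    exact Θ.map_of_mem ((mem_quotientSubgroup_adelicGroupData_iff F E c 1 J₁ _).2 ⟨γ, rfl⟩)
  refine ⟨torusChar F E c α hαc, (isAutomorphic_torusChar_iff F E c α hαc).2 hαaut, DFunLike.ext _ _ fun g => ?_⟩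
  change adelicOneChar F E c (torusChar F E c α hαc) (adelicDet F E c 1 J₁ hJ₁ g) = Θ g
  rw [adelicOneChar_torusChar]
  change Θ (adelicCenter F E c 1 J₁ (adelicDet F E c 1 J₁ hJ₁ g)) = Θ g
  rw [adelicCenter_adelicDet_of_one]

/-- **The local determinant `U(J₁)(F_v) → T(F_v)` is onto** (`N = 1`): `t = det ((t) )` for the scalar `(t) ∈ U(J₁)(F_v)` (★ `localUnitScalar`).
[cite: PlatonovRapinchuk1994, §6.2] -/
theorem exists_localDet_localPiEquiv_eq_of_one (hJ₁ : IsUnit J₁.det) (v : HeightOneSpectrum (𝓞 F)) (t : ↥(normOneUnits (conjLocal E c v))) :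
    ∃ k : localPi E c 1 J₁ v, localDet c v hJ₁ (localPiEquiv E c 1 J₁ v k) = t := by
  have ht : ((t : (LocalRing E v)ˣ) : LocalRing E v) * conjLocal E c v (t : (LocalRing E v)ˣ) = 1 := by
    rw [mul_comm]; exact (mem_normOneUnits_iff _).1 t.2
  refine ⟨localUnitScalar E c J₁ v (t : (LocalRing E v)ˣ) ht, Subtype.ext (Units.ext ?_)⟩
  rw [coe_coe_localDet]
  change Matrix.det ((localPiEquiv E c 1 J₁ v (localUnitScalar E c J₁ v (t : (LocalRing E v)ˣ) ht)).1 : GL (Fin 1) (LocalRing E v)).val = _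
  rw [coe_localPiEquiv_localUnitScalar, Matrix.det_smul, Matrix.det_one, mul_one, Fintype.card_fin, pow_one]

include h2 hc in
/-- **RIGIDITY FROM THE FINITE PLACES for `U(J₁)(𝔸_F)`** (`N = 1`): two unitary automorphic characters of `U(J₁)(𝔸_F)` which agree on `U(J₁)(F_v)`
(along ★ `inclPlaceAdelic v`) at every finite place `v` of `F` outside a finite set `S₀` are EQUAL — both are `ψ ∘ det`, `ψ′ ∘ det`
(`exists_eq_detChar_of_one`), the local components `ψ_v = ψ′_v` agree off `S₀` (§2 + `exists_localDet_localPiEquiv_eq_of_one`), and ★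
`torusCharacter_eq_of_torusLocalComponent_eq_of_not_mem` (Tate's density `E^× 𝕀_E^S` dense, archimedean places included) gives `ψ = ψ′`.
[cite: CasselsFrohlichANT1967, Ch. VII §4 Prop. 4.1 (proof)] [cite: PlatonovRapinchuk1994, §7.3 Prop. 7.8] -/
theorem _root_.Literature.NumberTheory.Automorphic.AdelicGroupData.AutomorphicCharacter.eq_of_forall_comp_inclPlaceAdelic_eq_of_one
    (hJ₁ : J₁.det ≠ 0) (S₀ : Finset (HeightOneSpectrum (𝓞 F))) (Θ Θ' : (adelicGroupData F E c 1 J₁).AutomorphicCharacter)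
    (h : ∀ v : HeightOneSpectrum (𝓞 F), v ∉ S₀ →
      Θ.toMonoidHom.comp (inclPlaceAdelic F E c 1 J₁ v) = Θ'.toMonoidHom.comp (inclPlaceAdelic F E c 1 J₁ v)) : Θ = Θ' := by
  obtain ⟨ψ, hψ, rfl⟩ := exists_eq_detChar_of_one F E c h2 hc J₁ hJ₁ Θ
  obtain ⟨ψ', hψ', rfl⟩ := exists_eq_detChar_of_one F E c h2 hc J₁ hJ₁ Θ'
  have hψψ' : ψ = ψ' := by
    refine torusCharacter_eq_of_torusLocalComponent_eq_of_not_mem c h2 hc S₀ ψ ψ' hψ hψ' fun v hv => MonoidHom.ext fun t => ?_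
    obtain ⟨k, hk⟩ := exists_localDet_localPiEquiv_eq_of_one F E c J₁ (isUnit_iff_ne_zero.2 hJ₁) v t
    rw [← hk, ← detChar_inclPlaceAdelic F E c h2 hc 1 J₁ ψ hψ hJ₁ v k, ← detChar_inclPlaceAdelic F E c h2 hc 1 J₁ ψ' hψ' hJ₁ v k]
    exact DFunLike.congr_fun (h v hv) k
  subst hψψ'
  rfl

include h2 hc in
/-- The same with NO exceptional set: two unitary automorphic characters of `U(J₁)(𝔸_F)` with the same restriction to every `U(J₁)(F_v)` are equal.
[cite: CasselsFrohlichANT1967, Ch. VII §4 Prop. 4.1 (proof)] -/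
theorem _root_.Literature.NumberTheory.Automorphic.AdelicGroupData.AutomorphicCharacter.eq_of_forall_comp_inclPlaceAdelic_eq_of_one'
    (hJ₁ : J₁.det ≠ 0) (Θ Θ' : (adelicGroupData F E c 1 J₁).AutomorphicCharacter)
    (h : ∀ v : HeightOneSpectrum (𝓞 F), Θ.toMonoidHom.comp (inclPlaceAdelic F E c 1 J₁ v) = Θ'.toMonoidHom.comp (inclPlaceAdelic F E c 1 J₁ v)) :
    Θ = Θ' :=
  AdelicGroupData.AutomorphicCharacter.eq_of_forall_comp_inclPlaceAdelic_eq_of_one F E c h2 hc J₁ hJ₁ ∅ Θ Θ' fun v _ => h v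

end Quadratic

/-! ## §4 The CM specialisations (`E = L`, `F = L⁺`, `c` = complex conjugation) -/

section CM

variable (L : Type) [Field L] [NumberField L] [IsCMField L] (N : ℕ) (H : Matrix (Fin N) (Fin N) L)

/-- **`ψ ∘ det` on `U(H)(𝔸_{L⁺})`** for an automorphic character `ψ` of `U(1)_{L/L⁺}(𝔸)` (the CM form of `detChar`).
[cite: Rogawski1990, §13.3 p. 202] -/
def cmDetChar (ψ : ↥(TorusDict.torus (IsCMField.complexConj L)) →ₜ* ℂˣ) (hψ : TorusDict.IsAutomorphic (IsCMField.complexConj L) ψ) (hH : H.det ≠ 0) :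
    (adelicGroupData ↥(maximalRealSubfield L) L (IsCMField.complexConj L) N H).AutomorphicCharacter :=
  detChar ↥(maximalRealSubfield L) L (IsCMField.complexConj L) (Algebra.IsQuadraticExtension.finrank_eq_two _ L)
    (IsCMField.complexConj_ne_one (K := L)) N H ψ hψ hH

/-- Unfolding of the CM form. [cite: Rogawski1990, §13.3 p. 202] -/
theorem cmDetChar_apply (ψ : ↥(TorusDict.torus (IsCMField.complexConj L)) →ₜ* ℂˣ) (hψ : TorusDict.IsAutomorphic (IsCMField.complexConj L) ψ)
    (hH : H.det ≠ 0) (g : (adelicGroupData ↥(maximalRealSubfield L) L (IsCMField.complexConj L) N H).Adelic) :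
    cmDetChar L N H ψ hψ hH g =
      ψ (adelicOneEquivTorus ↥(maximalRealSubfield L) L (IsCMField.complexConj L)
        (adelicDet ↥(maximalRealSubfield L) L (IsCMField.complexConj L) N H hH g)) :=
  rfl

/-- **CM LOCAL COMPONENTS**: `cmDetChar ψ (inclPlaceAdelic v k) = ψ_v (det (localPiEquiv v k))`. [cite: Rogawski1990, §12.2 pp. 173–174] -/
theorem cmDetChar_inclPlaceAdelic (ψ : ↥(TorusDict.torus (IsCMField.complexConj L)) →ₜ* ℂˣ) (hψ : TorusDict.IsAutomorphic (IsCMField.complexConj L) ψ)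
    (hH : H.det ≠ 0) (v : HeightOneSpectrum (𝓞 ↥(maximalRealSubfield L))) (k : localPi L (IsCMField.complexConj L) N H v) :
    cmDetChar L N H ψ hψ hH (inclPlaceAdelic ↥(maximalRealSubfield L) L (IsCMField.complexConj L) N H v k) =
      torusLocalComponent L (IsCMField.complexConj L) v ψ
        (localDet (IsCMField.complexConj L) v (isUnit_iff_ne_zero.2 hH) (localPiEquiv L (IsCMField.complexConj L) N H v k)) :=
  detChar_inclPlaceAdelic _ L _ _ _ N H ψ hψ hH v k

/-- **CM rigidity for `U(H₁)(𝔸_{L⁺})`, `H₁ ∈ M₁(L)`**: two unitary automorphic characters agreeing on `U(H₁)(L⁺_v)` off a finite set of finite places are equal.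
[cite: CasselsFrohlichANT1967, Ch. VII §4 Prop. 4.1 (proof)] -/
theorem cm_eq_of_forall_comp_inclPlaceAdelic_eq_of_one (H₁ : Matrix (Fin 1) (Fin 1) L) (hH₁ : H₁.det ≠ 0)
    (S₀ : Finset (HeightOneSpectrum (𝓞 ↥(maximalRealSubfield L))))
    (Θ Θ' : (adelicGroupData ↥(maximalRealSubfield L) L (IsCMField.complexConj L) 1 H₁).AutomorphicCharacter)
    (h : ∀ v : HeightOneSpectrum (𝓞 ↥(maximalRealSubfield L)), v ∉ S₀ →
      Θ.toMonoidHom.comp (inclPlaceAdelic ↥(maximalRealSubfield L) L (IsCMField.complexConj L) 1 H₁ v) =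
        Θ'.toMonoidHom.comp (inclPlaceAdelic ↥(maximalRealSubfield L) L (IsCMField.complexConj L) 1 H₁ v)) : Θ = Θ' :=
  AdelicGroupData.AutomorphicCharacter.eq_of_forall_comp_inclPlaceAdelic_eq_of_one _ L _ (Algebra.IsQuadraticExtension.finrank_eq_two _ L)
    (IsCMField.complexConj_ne_one (K := L)) H₁ hH₁ S₀ Θ Θ' h

/-- **Every unitary automorphic character of `U(H₁)(𝔸_{L⁺})`, `H₁ ∈ M₁(L)`, is `ψ ∘ det`** for an automorphic character `ψ` of `U(1)_{L/L⁺}(𝔸)`.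
[cite: Rogawski1990, §13.3 p. 202] -/
theorem cm_exists_eq_cmDetChar_of_one (H₁ : Matrix (Fin 1) (Fin 1) L) (hH₁ : H₁.det ≠ 0)
    (Θ : (adelicGroupData ↥(maximalRealSubfield L) L (IsCMField.complexConj L) 1 H₁).AutomorphicCharacter) :
    ∃ (ψ : ↥(TorusDict.torus (IsCMField.complexConj L)) →ₜ* ℂˣ) (hψ : TorusDict.IsAutomorphic (IsCMField.complexConj L) ψ),
      cmDetChar L 1 H₁ ψ hψ hH₁ = Θ :=
  exists_eq_detChar_of_one _ L _ _ _ H₁ hH₁ Θ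

end CM

end UnitaryGroup

end Literature.NumberTheory.Automorphic

end
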